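import Summits.CriticalPhenomena.SAWScalingLimit.Theses.SAWRestrictionRigidity
import Literature.Probability.RandomPlanarGeometry.SAWScalingLimitFamily
import Literature.Probability.RandomPlanarGeometry.ChordalReversibility
import Literature.Probability.RandomPlanarGeometry.LatticeSimilarityCovariance
import Literature.Probability.RandomPlanarGeometry.ChordalRestrictionMarkov

/-!
# Line `birth` — registered skeleton for the crux `AxiomsOfLimit` (stmt-CriticalPhenomena-1370)

Crux (FIXED; rank 4 of `route-CriticalPhenomena-SAWRestrictionRigidity`, shared verbatim by the routes
SAWGaussianRotation, SAWInfinitesimalRigidity, SAWPoissonBanks, SAWRestrictionDescent, SAWPtolemyBoundary):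
every chordal family `P` that is the FULL scaling limit `(lim)` of the critical `δℤ²` SAW laws — for every
Dobrushin domain and EVERY endpoint approximation — satisfies the lattice-exact axioms that `Rigidity`
consumes:

  `P.IsRestriction ∧ (restriction-coupled Markov kernel) ∧ (reversal) ∧ (z ↦ r·iᵏ·z + w covariance)
   ∧ (conjugation covariance) ∧ (a.s. simple, meeting ∂D only at a, b)`.

The hypothesis `P.IsChordal ∧ (lim)` is, literally, `SAW.IsScalingLimitFamily P`
(`Literature/…/SAWScalingLimitFamily.lean`, `isScalingLimitFamily_iff` is `Iff.rfl`), and the six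
conjuncts are, literally, `P.IsRestriction`, `P.IsRestrictionMarkov` (`ChordalRestrictionMarkov.lean`),
`P.IsReversible` (`ChordalReversibility.lean`), the two clauses of `P.IsLatticeSimilarityCovariant`
(`LatticeSimilarityCovariance.lean`) and the simplicity clause — the definition items filed by the route's
planner have landed, so every stub below is stated in TREE VOCABULARY ONLY and lands verbatim as a
`Theorems/SAWRestrictionRigidityAxiomsOfLimit<Stub>.lean --supports stmt-CriticalPhenomena-1370`.

## The cut (the route header's own "NOT DECOMPOSED YET: AxiomsOfLimit ↦ {restriction + reversal +
## covariance passage, Markov passage, simplicity}", threaded so that each passage may use the earlier ones)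

* S1 `stub_latticeSymmetryPassage` — EXACT LATTICE SYMMETRIES PASS TO THE FULL LIMIT:
  `SAW.IsScalingLimitFamily P → P.IsReversible ∧ P.IsLatticeSimilarityCovariant`.
  Reversal: walk reversal is a weight-preserving bijection `SAW(Ω_δ;a,b) ≃ SAW(Ω_δ;b,a)` whose polyline is
  the time-reversed polyline (tree: `SupercriticalSAW.lawAt_map_sawReverse`, `curve_sawReverse`,
  `tendstoLaw_reverse_of_tendstoLaw`, `IsEndpointApprox.swap`), limits in law along `𝓝[>] 0` are unique
  (`TendstoLaw.unique` / `map_eq_map_of_tendstoLaw`), endpoint approximations always exist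
  (`SAW.exists_isEndpointApprox`) and `P D` depends only on `(carrier, a, b)`
  (`IsScalingLimitFamily.apply_eq_of_carrier_eq`, then `isReversible_of_swap`) — the S-sized part.
  Lattice similarities: quarter-turns `z ↦ iᵏ z` and conjugation map `δℤ²` to itself and transport
  `meshDomain / discreteDomainGraph / DomainSAW / weight / law / curve` exactly at every mesh (the
  transport API exists in the tree only for `z ↦ -z` on the disc: `SupercriticalSAW.sawNeg…`); dilations
  are exact through the mesh change `(λΩ)_δ = λ·Ω_{δ/λ}` (same lattice sites, `δ/λ → 0⁺` is again the full
  filter); translations by an axis-parallel `w` are exact only along `δ_n = |w|/n`, so one SPLICES the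
  translated endpoints into an arbitrary approximation of `D + w` (cf. `isEndpointApprox_splice`,
  `Cruxes/EventualTight/Disproof.lean`), restricts `(lim)` to the sequence and composes directions
  (`ChordalFamily.covariant_trans`). Size L (lattice transport API ×3 symmetries + splice). Plausibly TRUE
  unconditionally: every identity is exact at the lattice level and only uniqueness of limits is used.
* S2 `stub_simplePassage` — THE LIMIT IS CARRIED BY SIMPLE CURVES MEETING ∂D ONLY AT a, b:
  `SAW.IsScalingLimitFamily P → ∀ D, ∀ᵐ γ ∂(P D), γ ∈ CurveClass.simple ∧ γ.range ∩ frontier D ⊆ {a, b}`.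
  `CurveClass.simple` is not closed, so this is a genuine lattice estimate: no macroscopic near-self-touching
  and no boundary crawling of the `x_c`-SAW, uniformly in the mesh, under EVERY endpoint approximation
  (LSW04 §3.4.5 p.14 heuristic; Kennedy–Lawler arXiv:1109.3091 boundary effects; only sub-ballisticity,
  Duminil-Copin–Hammond 2013, is in print). Same statement as the open item `SAWConfRestriction.SimpleOfLimit`
  (stmt-CriticalPhenomena-0774) with the hypothesis bundled. Size L–XL.
* S3 `stub_restrictionPassage` — RESTRICTION PASSES TO THE LIMIT, GIVEN S2's conclusion:
  `SAW.IsScalingLimitFamily P → (simple ∧ boundary-avoiding a.s.) → P.IsRestriction`.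
  Lattice level: `P_δ^{D'}(T) · P_δ^{D}(γ ⊆ D'_δ) = P_δ^{D}(T ∩ {γ ⊆ D'_δ})` is an identity (LSW04 §3.4.5);
  the content is the passage: `{range ⊆ closure D'}` is closed (`CurveClass.isClosed_rangeSubset`) but has
  EMPTY interior (every curve starts at `a ∈ ∂D'`), so portmanteau must be run relative to the chordal
  curves of `D̄`, where the relative boundary is "touches `∂D' ∩ D` without crossing" (null touching, to be
  derived from monotonicity in `D'` + exactness at two nested domains) or "crawls on `∂D ∩ ∂D'`" (killed by
  the hypothesis from S2); sub-domains pinched at `a` or `b` give a `P D`-null event and a vacuous identity.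
  Weaker than the open item `SAWConfRestriction.RestrictionOfLimit` (stmt-CriticalPhenomena-0773; see the
  refuter notes there on largest-component bookkeeping for `D'_δ` versus `D_δ`). Size L.
* S4 `stub_markovPassage` (HARDEST) — THE RESTRICTION-COUPLED MARKOV KERNEL OF THE LIMIT, GIVEN S2, S3:
  `SAW.IsScalingLimitFamily P → P.IsRestriction → (simple ∧ boundary-avoiding a.s.) → P.IsRestrictionMarkov`.
  One must CONSTRUCT `Q D past` (law of the future given the explored initial piece) with the three
  `IsMarkovExtension` clauses (initial / disintegration at the hitting time of EVERY closed `F` / dependence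
  on the remaining slit domain, tip and target only) and the `IsRestrictionKernel` coupling (conditioned
  into any Dobrushin sub-domain of the slit domain pinned at the tip, the future is `P` there). Lattice
  level: the conditional future given a lattice past is the critical SAW of the slit graph, exactly; the
  passage needs stability of SAW limits in slit domains perturbed near the tip — beyond `(lim)`, which only
  speaks of Jordan domains — or an intrinsic construction of `Q` from `P` by restriction to shrinking Jordan
  neighbourhoods of the slit domain (uniqueness of such an extension: `AvoidanceDeterminesLaw_holds`, proved
  in the route). Note `IsRestrictionMarkov → IsRestriction` is in the tree
  (`ChordalFamily.IsRestrictionMarkov.isRestriction`), so S3 is the natural first half of S4, not a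
  consequence to be re-derived. Size XL.

`AxiomsOfLimit_of` (kernel-checked, no `sorry` of its own) threads S2 → S3 → S4 and unbundles S1; its
hypotheses are the four stubs under their registered names (`__Registered.stub_…`, see below) and its
conclusion is the route decl `Summit.CriticalPhenomena.SAWScalingLimit.Theses.SAWRestrictionRigidity.AxiomsOfLimit`
BY NAME (the five sibling copies have syntactically identical bodies, so the same term closes each of them).

Every stub is a CONSEQUENCE of the crux (each conclusion is a conjunct, extra hypotheses only weaken), so
the cut loses nothing: the four stubs hold iff the crux holds. No `Disproof.lean` exists for this crux yet
(`ledger crux ls stmt-CriticalPhenomena-1370`: no workfiles, 2026-08-17); negatives index checked (11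
entries, none a passage-to-the-limit statement). Inputs already PROVED in the tree and to be used, not
re-stubbed: `SAW.exists_isEndpointApprox`, `SAW.IsScalingLimitFamily.unique / apply_eq_of_carrier_eq`,
`TendstoLaw.unique`, `TendstoLaw.comp_continuous`, `SupercriticalSAW.tendstoLaw_reverse_of_tendstoLaw`,
`ChordalFamily.isReversible_of_swap`, `ChordalFamily.covariant_trans`,
`ChordalFamily.IsRestrictionMarkov.isRestriction`, `AvoidanceDeterminesLaw_holds`.
-/

noncomputable section

open MeasureTheory Filter Topology Set
open Literature.Probability.RandomPlanarGeometry Literature.Probability.LatticeModels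

namespace Summit.CriticalPhenomena.SAWScalingLimit.Cruxes.AxiomsOfLimit.Birth

/-! ### Vocabulary of the line: the four passages as named statements -/

/-- The simplicity / boundary-avoidance clause of the crux for one family `P` (conjunct (i) of `Rigidity`'s
hypotheses): every `P D` is carried by simple curves meeting `∂D` only at the two marked points. -/
def SimpleBoundaryAvoiding (P : ChordalFamily) : Prop :=
  ∀ D : DobrushinDomain, ∀ᵐ γ ∂(P D),
    γ ∈ CurveClass.simple ∧ γ.range ∩ frontier D.carrier ⊆ {D.pt 0, D.pt 1}

/-- **S1, named.** Exact lattice symmetries (reversal; `z ↦ r·iᵏ·z + w`; conjugation) pass to every full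
scaling-limit family. -/
def LatticeSymmetryPassage : Prop :=
  ∀ P : ChordalFamily, SAW.IsScalingLimitFamily P → P.IsReversible ∧ P.IsLatticeSimilarityCovariant

/-- **S2, named.** Every full scaling-limit family is carried by simple, boundary-avoiding curves. -/
def SimplePassage : Prop :=
  ∀ P : ChordalFamily, SAW.IsScalingLimitFamily P → SimpleBoundaryAvoiding P

/-- **S3, named.** Restriction passes to every simple, boundary-avoiding full scaling-limit family. -/
def RestrictionPassage : Prop :=
  ∀ P : ChordalFamily, SAW.IsScalingLimitFamily P → SimpleBoundaryAvoiding P → P.IsRestriction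

/-- **S4, named.** Every simple, boundary-avoiding full scaling-limit family with restriction carries a
restriction-coupled domain-Markov kernel. -/
def MarkovPassage : Prop :=
  ∀ P : ChordalFamily, SAW.IsScalingLimitFamily P → P.IsRestriction → SimpleBoundaryAvoiding P →
    P.IsRestrictionMarkov

/-! ### The stubs (the ONLY `sorry`s of this file)

Each stub is stated over TREE VOCABULARY ONLY (the named statements above unfolded by hand), so that it lands
verbatim as a `Theorems/…` file `--supports stmt-CriticalPhenomena-1370` without importing this workfile; the
`*_holds` theorems below certify definitionally that the unfolded text IS the named statement. -/

/-- **S1 — exact lattice symmetries pass to the full limit.** A full scaling-limit family of the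
critical `δℤ²` SAW is reversible (`P (D; b, a) = reverse_* P (D; a, b)`) and lattice-similarity covariant
(covariant under `z ↦ r·iᵏ·z + w`, `r > 0`, `k ∈ ℕ`, `w ∈ ℂ`, and under `z ↦ z̄`). Reversal, quarter-turns
and conjugation are exact at every mesh; dilations are exact through `(λΩ)_δ = λ·Ω_{δ/λ}`; translations
by axis-parallel `w` are exact along `δ_n = |w|/n` (splice + restrict the full-filter limit + compose);
throughout, limits in law along `𝓝[>] 0` are unique and endpoint approximations exist for every
Dobrushin domain (`SAW.exists_isEndpointApprox`). -/
theorem stub_latticeSymmetryPassage :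
    ∀ P : ChordalFamily, SAW.IsScalingLimitFamily P →
      P.IsReversible ∧ P.IsLatticeSimilarityCovariant := by
  sorry

/-- **S2 — the limit is carried by simple curves meeting `∂D` only at the marked points.** A genuine
uniform lattice estimate (no macroscopic near-self-touching, no boundary crawling of the critical SAW
under every endpoint approximation); `CurveClass.simple` is not a closed event, so nothing soft gives it.
Same statement as `SAWConfRestriction.SimpleOfLimit` with the hypothesis bundled. -/
theorem stub_simplePassage :
    ∀ P : ChordalFamily, SAW.IsScalingLimitFamily P →
      ∀ D : DobrushinDomain, ∀ᵐ γ ∂(P D),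
        γ ∈ CurveClass.simple ∧ γ.range ∩ frontier D.carrier ⊆ {D.pt 0, D.pt 1} := by
  sorry

/-- **S3 — restriction passes to the limit, given simplicity and boundary avoidance.** The lattice
restriction identity (LSW04 §3.4.5) is exact; the passage runs portmanteau relative to the chordal curves
of `D̄` on the closed event `{range ⊆ closure D'}`, whose relative boundary is null by "no touching of
`∂D' ∩ D` without crossing" (from monotonicity in `D'`) and "no crawling on `∂D`" (the hypothesis);
sub-domains pinched at `a` or `b` are `P D`-null, where the product identity is vacuous. -/
theorem stub_restrictionPassage :
    ∀ P : ChordalFamily, SAW.IsScalingLimitFamily P →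
      (∀ D : DobrushinDomain, ∀ᵐ γ ∂(P D),
        γ ∈ CurveClass.simple ∧ γ.range ∩ frontier D.carrier ⊆ {D.pt 0, D.pt 1}) →
      P.IsRestriction := by
  sorry

/-- **S4 (hardest) — the restriction-coupled domain-Markov kernel of the limit, given restriction and
simplicity.** Construct `Q D past` with `P.IsMarkovExtension Q` (initial clause, disintegration of `P D` at
the hitting time of every closed set, dependence only on the remaining slit domain, tip and target) and
`P.IsRestrictionKernel Q` (conditioned into any Dobrushin sub-domain of the slit domain pinned at the tip,
the future is `P` there). Lattice level: the conditional future given a lattice past IS the critical SAW of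
the slit graph; the passage needs stability of SAW limits in slit domains perturbed near the tip, or an
intrinsic construction of `Q` from `P` through restriction to Jordan sub-domains (unique by
`AvoidanceDeterminesLaw_holds`). -/
theorem stub_markovPassage :
    ∀ P : ChordalFamily, SAW.IsScalingLimitFamily P → P.IsRestriction →
      (∀ D : DobrushinDomain, ∀ᵐ γ ∂(P D),
        γ ∈ CurveClass.simple ∧ γ.range ∩ frontier D.carrier ⊆ {D.pt 0, D.pt 1}) →
      P.IsRestrictionMarkov := by
  sorry

/-! ### Consistency: each named statement IS its registered stub (definitionally) -/

theorem latticeSymmetryPassage_holds : LatticeSymmetryPassage := stub_latticeSymmetryPassage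
theorem simplePassage_holds : SimplePassage := stub_simplePassage
theorem restrictionPassage_holds : RestrictionPassage := stub_restrictionPassage
theorem markovPassage_holds : MarkovPassage := stub_markovPassage

/-! ### Name-keyed aliases of the four statements — the hypotheses of `AxiomsOfLimit_of`

The native skeleton audit (`#h21_check_skeleton`) admits a hypothesis of the skeleton theorem only if its head
constant is a registered obligation or is NAMED like a declared stub; `__Registered.stub_X` is the statement of
`stub_X` under that name (device of `RiemannHypothesis/…/Lines/pencil_bracket_count.lean`: the `__` namespace is an
implementation detail, so the audit's stub report resolves each `stub_…` to the sorried theorem, not to the alias;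
the gate-reserved `@[stub]` attribute is not written by a planner). Each alias is `rfl`-equal to its statement. -/
namespace __Registered

/-- Alias of `LatticeSymmetryPassage` keyed by the registered stub name. -/
abbrev stub_latticeSymmetryPassage : Prop := LatticeSymmetryPassage
/-- Alias of `SimplePassage` keyed by the registered stub name. -/
abbrev stub_simplePassage : Prop := SimplePassage
/-- Alias of `RestrictionPassage` keyed by the registered stub name. -/
abbrev stub_restrictionPassage : Prop := RestrictionPassage
/-- Alias of `MarkovPassage` keyed by the registered stub name. -/
abbrev stub_markovPassage : Prop := MarkovPassage

end __Registered

/-! ### The skeleton theorem: the four stubs imply the crux, BY NAME -/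

/-- **`AxiomsOfLimit` from the line `birth`** (kernel-checked, no `sorry` of its own): bundle the crux's
hypotheses into `SAW.IsScalingLimitFamily P`, run S2 (simplicity), feed it to S3 (restriction), feed both
to S4 (restriction-coupled Markov kernel), unbundle S1 (reversal + lattice-similarity covariance), and
reassemble the six conjuncts; every identification is definitional (`isScalingLimitFamily_iff`,
`isReversible_iff`, `isLatticeSimilarityCovariant_iff`, `isRestrictionMarkov_iff` are all `Iff.rfl`).
Hypotheses = the four stubs, under their registered names; conclusion = the route decl, by name. -/
theorem AxiomsOfLimit_of (hY : __Registered.stub_latticeSymmetryPassage)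
    (hS : __Registered.stub_simplePassage) (hR : __Registered.stub_restrictionPassage)
    (hM : __Registered.stub_markovPassage) :
    Summit.CriticalPhenomena.SAWScalingLimit.Theses.SAWRestrictionRigidity.AxiomsOfLimit := by
  intro P hP hlim
  have hsl : SAW.IsScalingLimitFamily P := ⟨hP, hlim⟩
  have hs : SimpleBoundaryAvoiding P := hS P hsl
  have hr : P.IsRestriction := hR P hsl hs
  obtain ⟨Q, hQ, hK⟩ := hM P hsl hr hs
  obtain ⟨hrev, hsim, hconj⟩ := hY P hsl
  exact ⟨hr, ⟨Q, hQ, hK⟩, hrev, hsim, hconj, hs⟩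

/-- Wiring check (an `example`, so that `AxiomsOfLimit_of` stays the only theorem concluding the crux): the
registered stubs, with their tree-vocabulary types, feed the skeleton theorem as stated — this term becomes the
crux proof when the four `sorry`s above are discharged. -/
example : Summit.CriticalPhenomena.SAWScalingLimit.Theses.SAWRestrictionRigidity.AxiomsOfLimit :=
  AxiomsOfLimit_of stub_latticeSymmetryPassage stub_simplePassage stub_restrictionPassage
    stub_markovPassage

end Summit.CriticalPhenomena.SAWScalingLimit.Cruxes.AxiomsOfLimit.Birth

end
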